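import Literature.Analysis.FluidPDE.NSGalerkinDifferenceEnergy
import Literature.Analysis.FluidPDE.NSGalerkinEstimates2D
import Literature.Analysis.FluidPDE.SerrinEnstrophyGronwall
import HarnessLib

/-!
# Discharge of `galerkin_tendsto_lerayHopf_torus2`: Galerkin trajectories converge to every
  Leray–Hopf solution on `𝕋²`

Analysis/FluidPDE discharge file for the named fact
`Literature.Analysis.FluidPDE.galerkin_tendsto_lerayHopf_torus2` of
`Literature.Analysis.FluidPDE.NSEnstrophyBalance2DGalerkin` (Foias–Manley–Rosa–Temam 2001,
*Navier–Stokes Equations and Turbulence*, Ch. II, Thm. 7.3, the two-dimensional uniqueness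
mechanism — "For uniqueness we work, as usual, with the equation satisfied by the difference of
two solutions" (p. 70), with App. II.A (A.44)–(A.47), (A.52); Lions–Prodi 1959; in the
weak–strong form of Serrin 1963, §4, the strong solutions being the Galerkin approximations):
on `𝕋²`, Galerkin trajectories `Uₙ = galerkinVelocity (freqBall Nₙ) (αₙ)`, `Nₙ → ∞`, with energy,
enstrophy and palinstrophy bounded uniformly by `B`, converge in `L²` at every `t ∈ (0, T]` to
ANY Leray–Hopf solution `u` with the same data.

Proof (files `NSGalerkinCrossIdentity`, `NSGalerkinDifferenceIdentities`,
`NSGalerkinTimeBookkeeping`, `NSGalerkinDifferenceEnergy`, `NSGalerkinEstimates2D`):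
the energy inequality for `w = u - Uₙ` (`IsGalerkinTrajectory.difference_energy_le`),
`∫|w(t)|² + 2ν∫₀ᵗ‖∇w‖² ≤ ∫|u₀ - P_N u₀|² + 2∫₀ᵗ(∫⟪f - P_N f, u⟫ - ∫⟪w,(w·∇)U⟫ - ∫⟪u - P_N u,(U·∇)U⟫)`,
is bounded term by term on `𝕋²`: `|∫⟪f - P_N f, u⟫| ≤ ‖f - P_N f‖₂ √M`,
`2|∫⟪w,(w·∇)U⟫| ≤ ν‖∇w‖² + K∫|w|²` (Ladyzhenskaya, `two_mul_abs_integral_inner_convect_le`),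
`∫₀ᵀ|∫⟪u - P_N u,(U·∇)U⟫| ≤ Q/√(N²+1)` (spectral gap and the sup bound by the palinstrophy,
`abs_integral_inner_sub_fourierTruncate_convect_le`), so that
`∫|w(t)|² ≤ εₙ + K∫₀ᵗ∫|w|²` with `εₙ → 0`, and Grönwall's lemma
(`lintegral_gronwall_le`, Robinson–Rodrigo–Sadowski 2016, Lemma A.25) gives
`∫|w(t)|² ≤ εₙ e^{KT} → 0` (`IsGalerkinTrajectory.integral_norm_sub_sq_le_exp`), whence
`‖Uₙ(t) - u(t)‖_{L²} → 0` (`galerkin_tendsto_lerayHopf_torus2_holds`).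

## References

* C. Foias, O. Manley, R. Rosa, R. Temam, *Navier–Stokes Equations and Turbulence*, CUP 2001,
  Ch. II §7, Thm. 7.3, p. 70; App. II.A (A.44)–(A.47), (A.52) (PDF pp. 70–73, 115–118).
* J.-L. Lions, G. Prodi, C. R. Acad. Sci. Paris 248 (1959), 3519–3521.
* J. Serrin, *The initial value problem for the Navier–Stokes equations* (1963), §4.
* J. C. Robinson, J. L. Rodrigo, W. Sadowski, *The three-dimensional Navier–Stokes equations*,
  CUP 2016, Lemma 8.18, (8.12), Lemma A.25.
-/

noncomputable section

open MeasureTheory TopologicalSpace Set Function Filter UnitAddTorus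
open scoped InnerProductSpace RealInnerProductSpace ENNReal NNReal Topology

namespace Literature.Analysis.FluidPDE

open FunctionSpaces.Torus Torus

section Gronwall

variable {ν T : ℝ} {N : ℕ} {f u₀ : UnitAddTorus (Fin 2) → EuclideanSpace ℝ (Fin 2)}
  {u : ℝ → UnitAddTorus (Fin 2) → EuclideanSpace ℝ (Fin 2)}
  {α : ℝ → ↥(freqBall (d := Fin 2) N) → EuclideanSpace ℂ (Fin 2)}

/-- The initial Galerkin velocity is the Fourier truncation of the datum: `U(0) = P_N u₀`. [folklore] -/
theorem IsGalerkinTrajectory.galerkinVelocity_zero_eq_fourierTruncate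
    (h : IsGalerkinTrajectory ν (freqBall N) f u₀ α) :
    galerkinVelocity (freqBall N) α 0 = fourierTruncate N u₀ := by
  rw [galerkinVelocity_apply, h.initial, fourierTruncate_eq]
  exact realTrigPoly_congr fun k hk => by rw [coeffExt_of_mem _ hk, fourierRestrict_apply]

/-- The Galerkin force is the Fourier truncation of the force: `realTrigPoly (f̂|_{≤N})‾ = P_N f`. [folklore] -/
theorem realTrigPoly_coeffExt_fourierRestrict_eq_fourierTruncate (N : ℕ)
    (f : UnitAddTorus (Fin 2) → EuclideanSpace ℝ (Fin 2)) :
    realTrigPoly (freqBall N) (coeffExt (freqBall N) (fourierRestrict (freqBall (d := Fin 2) N) f)) =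
      fourierTruncate N f := by
  rw [fourierTruncate_eq]
  exact realTrigPoly_congr fun k hk => by rw [coeffExt_of_mem _ hk, fourierRestrict_apply]

set_option maxHeartbeats 800000 in
/-- **The `L²` distance between a Leray–Hopf solution and a Galerkin trajectory on `𝕋²`,
Grönwall form.** Let `ν > 0`, `T > 0`, `f` smooth and steady, `u₀ ∈ L²`, `u` a Leray–Hopf solution
on `[0,T)` with these data and `∫‖u(t)‖² ≤ M` on `[0,T]`, `C < ∞` a Ladyzhenskaya constant, and
`α` a Galerkin trajectory of order `freqBall N` whose velocity `U` satisfies `∫‖U(t)‖² ≤ B`,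
`‖∇U(t)‖₂² ≤ B` on `[0,T]` and `∫₀ᵀ‖ΔU‖₂² ≤ B`. Then for every `t ∈ (0, T]`
`∫‖u(t) - U(t)‖² ≤ (∫‖u₀ - P_N u₀‖² + 2T√M ‖f - P_N f‖₂ + Q/√(N²+1)) exp(KT)` with
`K = 2√(CB) + CB/ν`, `Q = (∫₀ᵀ‖∇u‖₂² + K₄B(BT + B/(16π⁴)))/(2π)`, `K₄ = ∑_{ℤ²}(1+|k|⁴)⁻¹`
(the energy inequality for the difference, the three pointwise bounds of `NSGalerkinEstimates2D`,
and Grönwall's lemma; Foias–Manley–Rosa–Temam 2001, Thm. 7.3 / (A.52); Robinson–Rodrigo–Sadowski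
2016, (8.12) and Lemma A.25). [cite: FoiasManleyRosaTemam2001, Ch. II Thm. 7.3; App. II.A (A.46)–(A.47), (A.52)] -/
theorem IsGalerkinTrajectory.integral_norm_sub_sq_le_exp (h : IsGalerkinTrajectory ν (freqBall N) f u₀ α)
    (hν : 0 < ν) (hT : 0 < T) (hf : FunctionSpaces.Torus.IsSmooth f) (hu₀ : MemLp u₀ 2 volume)
    (hu : Torus.IsLerayHopfOn T ν (fun _ => f) u₀ u) {M : ℝ} (hM : ∀ t ∈ Icc 0 T, ∫ x, ‖u t x‖ ^ 2 ≤ M)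
    {C : ℝ≥0∞} (hC : C ≠ ⊤)
    (hL : ∀ v : UnitAddTorus (Fin 2) → EuclideanSpace ℝ (Fin 2), MemLp v 2 volume →
      ∫⁻ x, ‖v x‖ₑ ^ 4 ≤ C * ((∫⁻ x, ‖v x‖ₑ ^ 2) * ((∫⁻ x, ‖v x‖ₑ ^ 2) + eGradNormSq v)))
    {B : ℝ≥0} (hB : ∀ t ∈ Icc 0 T, ∫⁻ x, ‖galerkinVelocity (freqBall N) α t x‖ₑ ^ 2 ≤ B ∧
      eGradNormSq (galerkinVelocity (freqBall N) α t) ≤ B)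
    (hP : ∫⁻ τ in Ioo 0 T, eLaplacianNormSq (galerkinVelocity (freqBall N) α τ) ≤ B)
    {t : ℝ} (ht : t ∈ Ioc 0 T) :
    ∫ x, ‖u t x - galerkinVelocity (freqBall N) α t x‖ ^ 2 ≤
      ((∫ x, ‖u₀ x - fourierTruncate N u₀ x‖ ^ 2) +
        2 * T * Real.sqrt M * Real.sqrt (∫ x, ‖f x - fourierTruncate N f x‖ ^ 2) +
        ((∫⁻ τ in Ioo 0 T, eGradNormSq (u τ)).toReal +
          (∑' k : Fin 2 → ℤ, (1 + freqNormSq k ^ 2)⁻¹) * B * (B * T + B / (16 * Real.pi ^ 4))) /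
          (2 * Real.pi) / Real.sqrt ((N : ℝ) ^ 2 + 1)) *
      Real.exp ((2 * Real.sqrt (C.toReal * B) + C.toReal * B / ν) * T) := by
  -- notation
  have hS : ∀ k ∈ freqBall (d := Fin 2) N, -k ∈ freqBall (d := Fin 2) N := h.symm
  set U : ℝ → UnitAddTorus (Fin 2) → EuclideanSpace ℝ (Fin 2) := galerkinVelocity (freqBall N) α with hU_def
  have hUs : ∀ s, FunctionSpaces.Torus.IsSmooth (U s) := fun s => isSmooth_realTrigPoly _ _
  have hreal : ∀ s, IsRealCoeff (α s) := fun s => (h.mem s).1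
  have hαT : ContinuousOn α (Icc 0 T) := h.continuousOn.mono Icc_subset_Ici_self
  have hUc : ContinuousOn (uncurry U) (Icc 0 T ×ˢ univ) := continuousOn_galerkin_prod hαT
  -- constants
  set K₄ : ℝ := ∑' k : Fin 2 → ℤ, (1 + freqNormSq k ^ 2)⁻¹ with hK₄
  have hK₄0 : 0 ≤ K₄ := tsum_nonneg fun k => by have := freqNormSq_nonneg k; positivity
  set Br : ℝ := (B : ℝ) with hBr
  have hBr0 : 0 ≤ Br := B.2
  set C' : ℝ := C.toReal with hC'
  have hC'0 : 0 ≤ C' := ENNReal.toReal_nonneg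
  set K : ℝ := 2 * Real.sqrt (C' * Br) + C' * Br / ν with hKdef
  have hK0 : 0 ≤ K := by positivity
  set Etot : ℝ := (∫⁻ τ in Ioo 0 T, eGradNormSq (u τ)).toReal with hEtot
  have hEtot0 : 0 ≤ Etot := ENNReal.toReal_nonneg
  set δ : ℝ := Real.sqrt (∫ x, ‖f x - fourierTruncate N f x‖ ^ 2) with hδ
  have hδ0 : 0 ≤ δ := Real.sqrt_nonneg _
  set W0 : ℝ := ∫ x, ‖u₀ x - fourierTruncate N u₀ x‖ ^ 2 with hW0
  have hW00 : 0 ≤ W0 := integral_nonneg fun x => sq_nonneg _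
  have hM0 : 0 ≤ M := (integral_nonneg fun x => sq_nonneg _).trans (hM 0 ⟨le_rfl, hT.le⟩)
  set X : ℝ := Etot + K₄ * Br * (Br * T + Br / (16 * Real.pi ^ 4)) with hX
  have hX0 : 0 ≤ X := by positivity
  set ρ : ℝ := Real.sqrt ((N : ℝ) ^ 2 + 1) with hρ
  have hρ0 : 0 < ρ := Real.sqrt_pos.2 (by positivity)
  set ε : ℝ := W0 + 2 * T * Real.sqrt M * δ + X / (2 * Real.pi) / ρ with hε
  have hε0 : 0 ≤ ε := by positivity
  -- the slice functionals
  set W : ℝ → ℝ := fun s => ∫ x, ‖u s x - U s x‖ ^ 2 with hWdef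
  set E : ℝ → ℝ := fun s => (eGradNormSq (u s)).toReal with hEdef
  set Pl : ℝ → ℝ := fun s => (eLaplacianNormSq (U s)).toReal with hPl
  set D : ℝ → ℝ := fun s => (eGradNormSq (u s)).toReal + (eGradNormSq (U s)).toReal +
    2 * ∫ x, ⟪u s x, FunctionSpaces.Torus.laplacian (U s) x⟫ with hDdef
  set Γ : ℝ → ℝ := fun s => K₄ * (Br + Pl s / (16 * Real.pi ^ 4)) * Br with hΓ
  -- real forms of the uniform bounds on `U`
  have hEU : ∀ s ∈ Icc 0 T, ∫ x, ‖U s x‖ ^ 2 ≤ Br := by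
    intro s hs
    have h1 := (hB s hs).1
    rw [lintegral_enorm_sq_eq_ofReal (h.memLp s 2)] at h1
    have h2 := (ENNReal.ofReal_le_iff_le_toReal ENNReal.coe_ne_top).1 h1
    rwa [ENNReal.coe_toReal] at h2
  have hGU : ∀ s ∈ Icc 0 T, eGradNormSq (U s) ≤ ENNReal.ofReal Br := fun s hs => by
    rw [hBr, ENNReal.ofReal_coe_nnreal]; exact (hB s hs).2
  have hGU' : ∀ s ∈ Icc 0 T, (eGradNormSq (U s)).toReal ≤ Br := fun s hs => by
    have := ENNReal.toReal_mono ENNReal.ofReal_ne_top (hGU s hs)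
    rwa [ENNReal.toReal_ofReal hBr0] at this
  have hPint : (∫ s in Ioc 0 T, Pl s) ≤ Br := by
    rw [hPl, ← h.toReal_lintegral_eLaplacianNormSq le_rfl]
    have := ENNReal.toReal_mono ENNReal.coe_ne_top hP
    rwa [ENNReal.coe_toReal] at this
  have hPl0 : ∀ s, 0 ≤ Pl s := fun s => ENNReal.toReal_nonneg
  have hPl_cont : ContinuousOn Pl (Icc 0 T) := h.continuousOn_toReal_eLaplacianNormSq.mono Icc_subset_Ici_self
  -- `W` is bounded on `[0, T]`
  have hWbd : ∀ s ∈ Icc 0 T, W s ≤ 2 * M + 2 * Br := by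
    intro s hs
    refine (integral_norm_sub_sq_le (hu.memLp s hs) (h.memLp s 2)).trans ?_
    linarith [hM s hs, hEU s hs]
  have hWnn : ∀ s, 0 ≤ W s := fun s => integral_nonneg fun x => sq_nonneg _
  -- integrability of the slice functionals on `(0, T)`
  have hW_int : IntegrableOn W (Ioo 0 T) := hu.integrableOn_integral_norm_sub_sq (Z := U) hUc
  have hE_int : IntegrableOn E (Ioo 0 T) :=
    integrable_toReal_of_lintegral_ne_top hu.aemeasurable_eGradNormSq hu.lintegral_eGradNormSq_lt_top.ne
  have hEU_cont : ContinuousOn (fun s => (eGradNormSq (U s)).toReal) (Icc 0 T) :=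
    continuousOn_toReal_eGradNormSq_galerkin hS hαT fun s _ => hreal s
  have hD_int : IntegrableOn D (Ioo 0 T) :=
    (hE_int.add (hEU_cont.integrableOn_Icc.mono_set Ioo_subset_Icc_self)).add
      ((hu.integrableOn_integral_inner_laplacian_galerkin hαT).const_mul 2)
  have hΓ_int : IntegrableOn Γ (Ioo 0 T) := by
    have hc : ContinuousOn Γ (Icc 0 T) :=
      (continuousOn_const.mul (continuousOn_const.add (hPl_cont.div_const _))).mul continuousOn_const
    exact hc.integrableOn_Icc.mono_set Ioo_subset_Icc_self
  -- finiteness of the dissipation of `u` for a.e. time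
  have hfin_ae : ∀ᵐ s ∂(volume.restrict (Ioo 0 T)), eGradNormSq (u s) < ⊤ :=
    ae_lt_top' hu.aemeasurable_eGradNormSq hu.lintegral_eGradNormSq_lt_top.ne
  -- the dissipation of `w = u - U` is `D`, where finite
  have hDeq : ∀ s ∈ Icc 0 T, eGradNormSq (u s) ≠ ⊤ → (eGradNormSq (u s - U s)).toReal = D s :=
    fun s hs hfin => toReal_eGradNormSq_sub_realTrigPoly hS (hu.memLp s hs) hfin (hreal s)
  have hDfin : ∀ s ∈ Icc 0 T, eGradNormSq (u s) ≠ ⊤ → eGradNormSq (u s - U s) ≠ ⊤ := by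
    intro s hs hfin
    refine ne_top_of_le_ne_top ?_ (Torus.eGradNormSq_sub_le ((hu.memLp s hs).integrable one_le_two)
      ((h.memLp s 2).integrable one_le_two))
    exact ENNReal.add_ne_top.2 ⟨ENNReal.mul_ne_top (by simp) hfin,
      ENNReal.mul_ne_top (by simp) (h.eGradNormSq_ne_top s)⟩
  -- the Galerkin force and datum are Fourier truncations
  have hGf : realTrigPoly (freqBall N) (coeffExt (freqBall N) (fourierRestrict (freqBall (d := Fin 2) N) f)) =
      fourierTruncate N f := realTrigPoly_coeffExt_fourierRestrict_eq_fourierTruncate N f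
  have hU0 : U 0 = fourierTruncate N u₀ := h.galerkinVelocity_zero_eq_fourierTruncate
  -- the pointwise bound on the error terms
  have hpt : ∀ s ∈ Ioc 0 T, eGradNormSq (u s) < ⊤ →
      (∫ x, ⟪f x - realTrigPoly (freqBall N) (coeffExt (freqBall N) (fourierRestrict (freqBall N) f)) x, u s x⟫) -
          (∫ x, ⟪u s x - U s x, FunctionSpaces.Torus.convect (u s - U s) (U s) x⟫) -
          (∫ x, ⟪u s x - realTrigPoly (freqBall N) (fun l => mFourierCoeff
              (FunctionSpaces.EuclideanSpace.complexify ∘ u s) l) x,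
            FunctionSpaces.Torus.convect (U s) (U s) x⟫) ≤
        Real.sqrt M * δ + (ν / 2 * D s + K / 2 * W s) + (E s + Γ s) / (4 * Real.pi * ρ) := by
    intro s hs hfin
    have hsT : s ∈ Icc 0 T := ⟨hs.1.le, hs.2⟩
    have hus : MemLp (u s) 2 volume := hu.memLp s hsT
    -- (a) the force error
    have ha : |∫ x, ⟪f x - realTrigPoly (freqBall N) (coeffExt (freqBall N) (fourierRestrict (freqBall N) f)) x, u s x⟫| ≤
        Real.sqrt M * δ := by
      rw [hGf]
      have h1 := abs_integral_inner_le_sqrt_mul_sqrt (μ := volume)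
        ((hf.memLp 2).sub (memLp_fourierTruncate N f 2)) hus
      refine h1.trans ?_
      rw [mul_comm]
      exact mul_le_mul (Real.sqrt_le_sqrt (hM s hsT)) le_rfl hδ0 (Real.sqrt_nonneg _)
    -- (b) the trilinear term absorbed by the dissipation
    have hwmem : MemLp (u s - U s) 2 volume := hus.sub (h.memLp s 2)
    have hDs : eGradNormSq (u s - U s) = ENNReal.ofReal (D s) := by
      rw [← hDeq s hsT hfin.ne, ENNReal.ofReal_toReal (hDfin s hsT hfin.ne)]
    have hD0 : 0 ≤ D s := by rw [← hDeq s hsT hfin.ne]; exact ENNReal.toReal_nonneg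
    have hb := two_mul_abs_integral_inner_convect_le hwmem hD0 hDs (hUs s) hBr0 (hGU s hsT) hC hL hν
    simp only [Pi.sub_apply] at hb
    -- (c) the truncation error
    have hΓs : ∫ x, ‖FunctionSpaces.Torus.convect (U s) (U s) x‖ ^ 2 ≤ Γ s := by
      refine (h.integral_norm_convect_galerkinVelocity_sq_le s).trans ?_
      change K₄ * ((∫ y, ‖U s y‖ ^ 2) + Pl s / (16 * Real.pi ^ 4)) * (eGradNormSq (U s)).toReal ≤
        K₄ * (Br + Pl s / (16 * Real.pi ^ 4)) * Br
      have h1 : (∫ y, ‖U s y‖ ^ 2) + Pl s / (16 * Real.pi ^ 4) ≤ Br + Pl s / (16 * Real.pi ^ 4) := by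
        linarith [hEU s hsT]
      have h2 : 0 ≤ (∫ y, ‖U s y‖ ^ 2) + Pl s / (16 * Real.pi ^ 4) := by
        have := hPl0 s
        have : 0 ≤ ∫ y, ‖U s y‖ ^ 2 := integral_nonneg fun y => sq_nonneg _
        positivity
      exact mul_le_mul (mul_le_mul_of_nonneg_left h1 hK₄0) (hGU' s hsT) ENNReal.toReal_nonneg
        (mul_nonneg hK₄0 (h2.trans h1))
    have hΓ0 : 0 ≤ Γ s := by have := hPl0 s; positivity
    have hc : |∫ x, ⟪u s x - realTrigPoly (freqBall N) (fun l => mFourierCoeff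
        (FunctionSpaces.EuclideanSpace.complexify ∘ u s) l) x, FunctionSpaces.Torus.convect (U s) (U s) x⟫| ≤
        (E s + Γ s) / (4 * Real.pi * ρ) :=
      abs_integral_inner_sub_fourierTruncate_convect_le hus hfin.ne (hUs s) hΓ0 hΓs N
    -- combine
    have ha' := (abs_le.1 ha)
    have hb' := (abs_le.1 (show |∫ x, ⟪u s x - U s x, FunctionSpaces.Torus.convect (u s - U s) (U s) x⟫| ≤
      (ν * D s + K * ∫ x, ‖u s x - U s x‖ ^ 2) / 2 by rw [le_div_iff₀ (by norm_num : (0:ℝ) < 2)]; linarith))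
    have hc' := (abs_le.1 hc)
    change _ ≤ Real.sqrt M * δ + (ν / 2 * D s + K / 2 * ∫ x, ‖u s x - U s x‖ ^ 2) + (E s + Γ s) / (4 * Real.pi * ρ)
    linarith [ha'.2, hb'.1, hc'.1]
  -- the bound integrated: `W τ ≤ ε + K ∫_{(0,τ]} W` for every `τ ∈ (0, T]`
  have hstep : ∀ τ ∈ Ioc 0 T, W τ ≤ ε + K * ∫ s in Ioc 0 τ, W s := by
    intro τ hτ
    have hmain := h.difference_energy_le hu hT hf hu₀ hτ
    have hIoc : ∀ {F : ℝ → ℝ}, IntegrableOn F (Ioo 0 T) → IntegrableOn F (Ioc 0 τ) := fun hF =>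
      integrableOn_Ioc_of_integrableOn_Ioo hF hτ.2
    -- integrability on `(0, τ]`
    have hΦ_int : IntegrableOn (fun s => ∫ x, ⟪f x - realTrigPoly (freqBall N)
        (coeffExt (freqBall N) (fourierRestrict (freqBall N) f)) x, u s x⟫) (Ioc 0 τ) := by
      have hc : Continuous (fun x => f x - realTrigPoly (freqBall N)
          (coeffExt (freqBall N) (fourierRestrict (freqBall N) f)) x) :=
        hf.continuous.sub (continuous_realTrigPoly _ _)
      refine hIoc ((hu.integrableOn_integral_inner hc).congr_fun (fun s _ => ?_) measurableSet_Ioo)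
      exact integral_congr_ae (ae_of_all _ fun x => real_inner_comm _ _)
    have hB1_int : IntegrableOn (fun s => ∫ x, ⟪u s x - U s x,
        FunctionSpaces.Torus.convect (u s - U s) (U s) x⟫) (Ioc 0 τ) :=
      hIoc (hu.integrableOn_trilinear_sub_galerkin hαT)
    have hB2_int : IntegrableOn (fun s => ∫ x, ⟪u s x - realTrigPoly (freqBall N) (fun l => mFourierCoeff
        (FunctionSpaces.EuclideanSpace.complexify ∘ u s) l) x, FunctionSpaces.Torus.convect (U s) (U s) x⟫) (Ioc 0 τ) :=
      hIoc (hu.integrableOn_truncation_trilinear_galerkin hS hαT fun s _ => hreal s)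
    have hL_int : IntegrableOn (fun s => (∫ x, ⟪f x - realTrigPoly (freqBall N)
        (coeffExt (freqBall N) (fourierRestrict (freqBall N) f)) x, u s x⟫) -
        (∫ x, ⟪u s x - U s x, FunctionSpaces.Torus.convect (u s - U s) (U s) x⟫) -
        ∫ x, ⟪u s x - realTrigPoly (freqBall N) (fun l => mFourierCoeff
          (FunctionSpaces.EuclideanSpace.complexify ∘ u s) l) x, FunctionSpaces.Torus.convect (U s) (U s) x⟫)
        (Ioc 0 τ) := (hΦ_int.sub hB1_int).sub hB2_int
    have hc_int : ∀ c : ℝ, IntegrableOn (fun _ : ℝ => c) (Ioc 0 τ) := fun c =>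
      integrableOn_const measure_Ioc_lt_top.ne
    have hR_int : IntegrableOn (fun s => Real.sqrt M * δ + (ν / 2 * D s + K / 2 * W s) +
        (E s + Γ s) / (4 * Real.pi * ρ)) (Ioc 0 τ) :=
      ((hc_int _).add (((hIoc hD_int).const_mul _).add ((hIoc hW_int).const_mul _))).add
        (((hIoc hE_int).add (hIoc hΓ_int)).div_const _)
    -- the a.e. pointwise bound on `(0, τ]`
    have hae : ∀ᵐ s ∂(volume.restrict (Ioc 0 τ)),
        (∫ x, ⟪f x - realTrigPoly (freqBall N) (coeffExt (freqBall N) (fourierRestrict (freqBall N) f)) x, u s x⟫) -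
          (∫ x, ⟪u s x - U s x, FunctionSpaces.Torus.convect (u s - U s) (U s) x⟫) -
          (∫ x, ⟪u s x - realTrigPoly (freqBall N) (fun l => mFourierCoeff
              (FunctionSpaces.EuclideanSpace.complexify ∘ u s) l) x,
            FunctionSpaces.Torus.convect (U s) (U s) x⟫) ≤
        Real.sqrt M * δ + (ν / 2 * D s + K / 2 * W s) + (E s + Γ s) / (4 * Real.pi * ρ) := by
      rw [Measure.restrict_congr_set (Ioo_ae_eq_Ioc (μ := volume) (a := 0) (b := τ)).symm]
      have h1 : ∀ᵐ s ∂(volume.restrict (Ioo 0 τ)), eGradNormSq (u s) < ⊤ :=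
        ae_restrict_of_ae_restrict_of_subset (Ioo_subset_Ioo_right hτ.2) hfin_ae
      filter_upwards [h1, ae_restrict_mem measurableSet_Ioo] with s hs hsI
      exact hpt s ⟨hsI.1, hsI.2.le.trans hτ.2⟩ hs
    have hD_nn : 0 ≤ ∫ s in Ioc 0 τ, D s := by
      rw [Measure.restrict_congr_set (Ioo_ae_eq_Ioc (μ := volume) (a := 0) (b := τ)).symm]
      refine integral_nonneg_of_ae ?_
      have h1 : ∀ᵐ s ∂(volume.restrict (Ioo 0 τ)), eGradNormSq (u s) < ⊤ :=
        ae_restrict_of_ae_restrict_of_subset (Ioo_subset_Ioo_right hτ.2) hfin_ae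
      filter_upwards [h1, ae_restrict_mem measurableSet_Ioo] with s hs hsI
      rw [Pi.zero_apply, ← hDeq s ⟨hsI.1.le, hsI.2.le.trans hτ.2⟩ hs.ne]
      exact ENNReal.toReal_nonneg
    -- integrate the pointwise bound
    have hI := integral_mono_ae hL_int hR_int hae
    have hRval : ∫ s in Ioc 0 τ, (Real.sqrt M * δ + (ν / 2 * D s + K / 2 * W s) + (E s + Γ s) / (4 * Real.pi * ρ)) =
        Real.sqrt M * δ * τ + (ν / 2 * (∫ s in Ioc 0 τ, D s) + K / 2 * ∫ s in Ioc 0 τ, W s) +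
          ((∫ s in Ioc 0 τ, E s) + ∫ s in Ioc 0 τ, Γ s) / (4 * Real.pi * ρ) := by
      have i0 : IntegrableOn (fun _ : ℝ => Real.sqrt M * δ) (Ioc 0 τ) := hc_int _
      have iD : IntegrableOn (fun s => ν / 2 * D s) (Ioc 0 τ) := (hIoc hD_int).const_mul _
      have iW : IntegrableOn (fun s => K / 2 * W s) (Ioc 0 τ) := (hIoc hW_int).const_mul _
      have i1 : IntegrableOn (fun s => ν / 2 * D s + K / 2 * W s) (Ioc 0 τ) := iD.add iW
      have i2 : IntegrableOn (fun s => (E s + Γ s) / (4 * Real.pi * ρ)) (Ioc 0 τ) :=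
        ((hIoc hE_int).add (hIoc hΓ_int)).div_const _
      have i01 : IntegrableOn (fun s => Real.sqrt M * δ + (ν / 2 * D s + K / 2 * W s)) (Ioc 0 τ) := i0.add i1
      have e1 : ∫ s in Ioc 0 τ, (Real.sqrt M * δ + (ν / 2 * D s + K / 2 * W s) + (E s + Γ s) / (4 * Real.pi * ρ)) =
          (∫ _ in Ioc 0 τ, Real.sqrt M * δ) + (∫ s in Ioc 0 τ, (ν / 2 * D s + K / 2 * W s)) +
            ∫ s in Ioc 0 τ, (E s + Γ s) / (4 * Real.pi * ρ) := by
        rw [integral_add i01 i2, integral_add i0 i1]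
      have e2 : (∫ _ in Ioc 0 τ, Real.sqrt M * δ) = Real.sqrt M * δ * τ := by
        rw [setIntegral_const, Real.volume_real_Ioc_of_le hτ.1.le, sub_zero, smul_eq_mul]; ring
      have e3 : (∫ s in Ioc 0 τ, (ν / 2 * D s + K / 2 * W s)) =
          ν / 2 * (∫ s in Ioc 0 τ, D s) + K / 2 * ∫ s in Ioc 0 τ, W s := by
        rw [integral_add iD iW, integral_const_mul (ν / 2) D, integral_const_mul (K / 2) W]
      have e4 : (∫ s in Ioc 0 τ, (E s + Γ s) / (4 * Real.pi * ρ)) =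
          ((∫ s in Ioc 0 τ, E s) + ∫ s in Ioc 0 τ, Γ s) / (4 * Real.pi * ρ) := by
        rw [integral_div, integral_add (hIoc hE_int) (hIoc hΓ_int)]
      rw [e1, e2, e3, e4]
    -- bounds on the constants' integrals
    have hE_le : (∫ s in Ioc 0 τ, E s) ≤ Etot := by
      have hE_T : IntegrableOn E (Ioc 0 T) := integrableOn_Ioc_of_integrableOn_Ioo hE_int le_rfl
      have h1 : (∫ s in Ioc 0 τ, E s) ≤ ∫ s in Ioc 0 T, E s :=
        setIntegral_mono_set hE_T (ae_of_all _ fun s => ENNReal.toReal_nonneg)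
          (ae_of_all _ (Ioc_subset_Ioc_right hτ.2))
      have h2 : (∫ s in Ioc 0 T, E s) = Etot := by
        rw [hEtot, ← integral_toReal hu.aemeasurable_eGradNormSq hfin_ae, integral_Ioc_eq_integral_Ioo]
      linarith
    have hΓ_le : (∫ s in Ioc 0 τ, Γ s) ≤ K₄ * Br * (Br * T + Br / (16 * Real.pi ^ 4)) := by
      have hPl_T : IntegrableOn Pl (Ioc 0 T) := hPl_cont.integrableOn_Icc.mono_set Ioc_subset_Icc_self
      have hPl_τ : IntegrableOn Pl (Ioc 0 τ) := hPl_T.mono_set (Ioc_subset_Ioc_right hτ.2)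
      have h1 : (∫ s in Ioc 0 τ, Pl s) ≤ Br := by
        refine le_trans ?_ hPint
        exact setIntegral_mono_set hPl_T (ae_of_all _ hPl0) (ae_of_all _ (Ioc_subset_Ioc_right hτ.2))
      have h2 : (∫ s in Ioc 0 τ, Γ s) = K₄ * Br * Br * τ + K₄ * Br / (16 * Real.pi ^ 4) * ∫ s in Ioc 0 τ, Pl s := by
        have heq : ∀ s, Γ s = K₄ * Br * Br + K₄ * Br / (16 * Real.pi ^ 4) * Pl s := fun s => by
          rw [hΓ]; ring
        have e1 : (∫ s in Ioc 0 τ, Γ s) = ∫ s in Ioc 0 τ, (K₄ * Br * Br + K₄ * Br / (16 * Real.pi ^ 4) * Pl s) :=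
          integral_congr_ae (ae_of_all _ heq)
        have iP : IntegrableOn (fun s => K₄ * Br / (16 * Real.pi ^ 4) * Pl s) (Ioc 0 τ) := hPl_τ.const_mul _
        have e2 : (∫ _ in Ioc 0 τ, K₄ * Br * Br) = K₄ * Br * Br * τ := by
          rw [setIntegral_const, Real.volume_real_Ioc_of_le hτ.1.le, sub_zero, smul_eq_mul]; ring
        rw [e1, integral_add (hc_int _) iP, e2, integral_const_mul (K₄ * Br / (16 * Real.pi ^ 4)) Pl]
      rw [h2]
      have h3 : K₄ * Br * Br * τ ≤ K₄ * Br * Br * T :=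
        mul_le_mul_of_nonneg_left hτ.2 (by positivity)
      have h4 : K₄ * Br / (16 * Real.pi ^ 4) * (∫ s in Ioc 0 τ, Pl s) ≤ K₄ * Br / (16 * Real.pi ^ 4) * Br :=
        mul_le_mul_of_nonneg_left h1 (by positivity)
      have h5 : K₄ * Br * Br * T + K₄ * Br / (16 * Real.pi ^ 4) * Br = K₄ * Br * (Br * T + Br / (16 * Real.pi ^ 4)) := by
        ring
      linarith
    have hconst : Real.sqrt M * δ * τ ≤ Real.sqrt M * δ * T :=
      mul_le_mul_of_nonneg_left hτ.2 (by positivity)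
    -- the datum term
    have hW0' : ∫ x, ‖u₀ x - U 0 x‖ ^ 2 = W0 := by rw [hU0]
    -- assemble
    have h2 : 2 * ∫ s in Ioc 0 τ, ((∫ x, ⟪f x - realTrigPoly (freqBall N)
        (coeffExt (freqBall N) (fourierRestrict (freqBall N) f)) x, u s x⟫) -
        (∫ x, ⟪u s x - U s x, FunctionSpaces.Torus.convect (u s - U s) (U s) x⟫) -
        ∫ x, ⟪u s x - realTrigPoly (freqBall N) (fun l => mFourierCoeff
          (FunctionSpaces.EuclideanSpace.complexify ∘ u s) l) x, FunctionSpaces.Torus.convect (U s) (U s) x⟫) ≤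
        2 * T * Real.sqrt M * δ + ν * (∫ s in Ioc 0 τ, D s) + K * (∫ s in Ioc 0 τ, W s) + X / (2 * Real.pi) / ρ := by
      rw [hRval] at hI
      have hρπ : 0 < 4 * Real.pi * ρ := by positivity
      have h3 : ((∫ s in Ioc 0 τ, E s) + ∫ s in Ioc 0 τ, Γ s) / (4 * Real.pi * ρ) ≤ X / (4 * Real.pi * ρ) :=
        div_le_div_of_nonneg_right (by rw [hX]; linarith) hρπ.le
      have h4 : 2 * (X / (4 * Real.pi * ρ)) = X / (2 * Real.pi) / ρ := by
        field_simp
        ring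
      linarith [hI, h3, h4, hconst]
    rw [hW0'] at hmain
    change W τ + 2 * ν * (∫ s in Ioc 0 τ, D s) ≤ W0 + 2 * ∫ s in Ioc 0 τ, _ at hmain
    have hνD : 0 ≤ ν * ∫ s in Ioc 0 τ, D s := mul_nonneg hν.le hD_nn
    rw [hε]
    linarith
  -- Grönwall
  set φ : ℝ → ℝ≥0∞ := fun τ => if 0 < τ then ENNReal.ofReal (W τ) else 0 with hφ
  have hφM : ∀ τ ∈ Icc 0 T, φ τ ≤ ENNReal.ofReal (2 * M + 2 * Br) := by
    intro τ hτ
    by_cases h0 : 0 < τ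
    · rw [hφ]; dsimp only; rw [if_pos h0]
      exact ENNReal.ofReal_le_ofReal (hWbd τ hτ)
    · rw [hφ]; dsimp only; rw [if_neg h0]
      exact bot_le
  have ha : ∫⁻ _ in Ioo 0 T, ENNReal.ofReal K ≠ ⊤ := by
    rw [setLIntegral_const]
    exact ENNReal.mul_ne_top ENNReal.ofReal_ne_top measure_Ioo_lt_top.ne
  have hφstep : ∀ τ ∈ Icc 0 T, φ τ ≤ ENNReal.ofReal ε + ∫⁻ s in Ioo 0 τ, ENNReal.ofReal K * φ s := by
    intro τ hτ
    by_cases h0 : 0 < τ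
    · have h1 := hstep τ ⟨h0, hτ.2⟩
      have hWτ : IntegrableOn W (Ioc 0 τ) := integrableOn_Ioc_of_integrableOn_Ioo hW_int hτ.2
      have h2 : ENNReal.ofReal (K * ∫ s in Ioc 0 τ, W s) = ∫⁻ s in Ioo 0 τ, ENNReal.ofReal K * φ s := by
        rw [ENNReal.ofReal_mul hK0, ofReal_integral_eq_lintegral_ofReal hWτ (ae_of_all _ hWnn),
          ← lintegral_const_mul' _ _ ENNReal.ofReal_ne_top, ← lintegral_Ioo_eq_lintegral_Ioc]
        refine setLIntegral_congr_fun measurableSet_Ioo fun s hs => ?_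
        rw [hφ]; dsimp only; rw [if_pos hs.1]
      rw [hφ]; dsimp only; rw [if_pos h0, ← h2, ← ENNReal.ofReal_add hε0 (mul_nonneg hK0 (integral_nonneg hWnn))]
      exact ENNReal.ofReal_le_ofReal h1
    · rw [hφ]; dsimp only; rw [if_neg h0]
      exact bot_le
  have hG := lintegral_gronwall_le (S := T) ENNReal.ofReal_ne_top ENNReal.ofReal_ne_top hφM ha hφstep t
    ⟨ht.1.le, ht.2⟩
  have hKt : (∫⁻ _ in Ioo 0 t, ENNReal.ofReal K).toReal = K * t := by
    rw [setLIntegral_const, ENNReal.toReal_mul, ENNReal.toReal_ofReal hK0, Real.volume_Ioo,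
      ENNReal.toReal_ofReal (by linarith [ht.1]), sub_zero]
  rw [hKt, hφ] at hG
  dsimp only at hG
  rw [if_pos ht.1, ← ENNReal.ofReal_mul hε0, ENNReal.ofReal_le_ofReal_iff (by positivity)] at hG
  refine hG.trans ?_
  refine mul_le_mul_of_nonneg_left (Real.exp_le_exp.2 ?_) hε0
  exact mul_le_mul_of_nonneg_left ht.2 hK0

end Gronwall

/-! ### The discharge -/

section Discharge

/-- **Discharge of `galerkin_tendsto_lerayHopf_torus2`** (Foias–Manley–Rosa–Temam 2001, Ch. II
Thm. 7.3, uniqueness mechanism in two dimensions, App. II.A (A.44)–(A.47), (A.52); Lions–Prodi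
1959; Serrin 1963, §4): on `𝕋²`, Galerkin trajectories with uniformly bounded energy, enstrophy
and palinstrophy converge in `L²`, at every `t ∈ (0, T]`, to every Leray–Hopf solution with the
same data. Real proof: the Grönwall bound `IsGalerkinTrajectory.integral_norm_sub_sq_le_exp`,
whose three `N`-dependent terms tend to zero (`P_N u₀ → u₀`, `P_N f → f` in `L²`, and
`1/√(N²+1) → 0`). [cite: FoiasManleyRosaTemam2001, Ch. II Thm. 7.3; App. II.A (A.44)–(A.47), (A.52)] -/
theorem galerkin_tendsto_lerayHopf_torus2_holds : galerkin_tendsto_lerayHopf_torus2 := by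
  intro ν T f u₀ u N α hν hT hf _hfdiv hu₀ _hu₀div hu hN hα hB t ht
  obtain ⟨B, hB⟩ := hB
  -- the uniform energy bound of `u` and a Ladyzhenskaya constant
  have hfm := aestronglyMeasurable_stLift_const hf (volume.restrict (Ioo 0 T ×ˢ univ))
  have hf₂ := lintegral_lintegral_enorm_sq_const_lt_top (hf.memLp 2) T
  obtain ⟨M', hM', hM⟩ := hu.exists_forall_lintegral_enorm_sq_le hν.le hfm hf₂
  have hMr : ∀ s ∈ Icc 0 T, ∫ x, ‖u s x‖ ^ 2 ≤ M'.toReal := by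
    intro s hs
    have h1 := hM s hs
    rw [lintegral_enorm_sq_eq_ofReal (hu.memLp s hs)] at h1
    exact (ENNReal.ofReal_le_iff_le_toReal hM').1 h1
  obtain ⟨C, hC, hL⟩ := exists_ladyzhenskaya_const_memLp
  -- abbreviations for the three vanishing terms and the constants
  set W0 : ℕ → ℝ := fun n => ∫ x, ‖u₀ x - fourierTruncate (N n) u₀ x‖ ^ 2 with hW0
  set δ : ℕ → ℝ := fun n => Real.sqrt (∫ x, ‖f x - fourierTruncate (N n) f x‖ ^ 2) with hδ
  set X : ℝ := (∫⁻ τ in Ioo 0 T, eGradNormSq (u τ)).toReal +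
    (∑' k : Fin 2 → ℤ, (1 + freqNormSq k ^ 2)⁻¹) * B * (B * T + B / (16 * Real.pi ^ 4)) with hX
  set K : ℝ := 2 * Real.sqrt (C.toReal * B) + C.toReal * B / ν with hK
  set ε : ℕ → ℝ := fun n => W0 n + 2 * T * Real.sqrt M'.toReal * δ n +
    X / (2 * Real.pi) / Real.sqrt ((N n : ℝ) ^ 2 + 1) with hε
  -- the Grönwall bound for every `n`
  have hbound : ∀ n, ∫ x, ‖u t x - galerkinVelocity (freqBall (N n)) (α n) t x‖ ^ 2 ≤ ε n * Real.exp (K * T) :=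
    fun n => (hα n).integral_norm_sub_sq_le_exp hν hT hf hu₀ hu hMr hC hL (hB n).1 (hB n).2 ht
  -- the three terms tend to zero
  have htrunc : ∀ {v : UnitAddTorus (Fin 2) → EuclideanSpace ℝ (Fin 2)}, MemLp v 2 volume →
      Tendsto (fun n => ∫ x, ‖v x - fourierTruncate (N n) v x‖ ^ 2) atTop (𝓝 0) := by
    intro v hv
    have h1 := (tendsto_lintegral_enorm_sq_fourierTruncate_sub hv).comp hN
    have h2 := (ENNReal.tendsto_toReal ENNReal.zero_ne_top).comp h1
    rw [ENNReal.toReal_zero] at h2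
    refine h2.congr fun n => ?_
    have hmem : MemLp (fun x => fourierTruncate (N n) v x - v x) 2 volume := (memLp_fourierTruncate (N n) v 2).sub hv
    simp only [Function.comp_apply]
    rw [lintegral_enorm_sq_eq_ofReal hmem, ENNReal.toReal_ofReal (integral_nonneg fun x => sq_nonneg _)]
    exact integral_congr_ae (ae_of_all _ fun x => by dsimp only; rw [norm_sub_rev])
  have hW0t : Tendsto W0 atTop (𝓝 0) := htrunc hu₀
  have hδt : Tendsto δ atTop (𝓝 0) := by
    have h := (Real.continuous_sqrt.tendsto 0).comp (htrunc (hf.memLp 2))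
    rwa [Real.sqrt_zero] at h
  have hρt : Tendsto (fun n => X / (2 * Real.pi) / Real.sqrt ((N n : ℝ) ^ 2 + 1)) atTop (𝓝 0) := by
    have h1 : Tendsto (fun n => Real.sqrt ((N n : ℝ) ^ 2 + 1)) atTop atTop := by
      refine tendsto_atTop_mono (fun n => ?_) (tendsto_natCast_atTop_atTop.comp hN)
      simp only [Function.comp_apply]
      calc (N n : ℝ) = Real.sqrt ((N n : ℝ) ^ 2) := (Real.sqrt_sq (Nat.cast_nonneg _)).symm
        _ ≤ Real.sqrt ((N n : ℝ) ^ 2 + 1) := Real.sqrt_le_sqrt (by linarith)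
    have h2 := (tendsto_inv_atTop_zero.comp h1).const_mul (X / (2 * Real.pi))
    rw [mul_zero] at h2
    simpa only [div_eq_mul_inv, Function.comp_apply] using h2
  have hεt : Tendsto ε atTop (𝓝 0) := by
    have h := (hW0t.add ((hδt.const_mul (2 * T * Real.sqrt M'.toReal)))).add hρt
    simpa only [mul_zero, add_zero] using h
  -- squeeze
  have hWt : Tendsto (fun n => ∫ x, ‖u t x - galerkinVelocity (freqBall (N n)) (α n) t x‖ ^ 2) atTop (𝓝 0) := by
    have h := hεt.mul_const (Real.exp (K * T))
    rw [zero_mul] at h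
    exact tendsto_of_tendsto_of_tendsto_of_le_of_le tendsto_const_nhds h
      (fun n => integral_nonneg fun x => sq_nonneg _) hbound
  -- the `L²` norm
  have heq : ∀ n, eLpNorm (galerkinVelocity (freqBall (N n)) (α n) t - u t) 2 volume =
      ENNReal.ofReal (∫ x, ‖u t x - galerkinVelocity (freqBall (N n)) (α n) t x‖ ^ 2) ^ (1 / 2 : ℝ) := by
    intro n
    have hmem : MemLp (galerkinVelocity (freqBall (N n)) (α n) t - u t) 2 volume :=
      ((hα n).memLp t 2).sub (hu.memLp t ⟨ht.1.le, ht.2⟩)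
    rw [eLpNorm_eq_lintegral_rpow_enorm_toReal two_ne_zero ENNReal.ofNat_ne_top]
    simp only [ENNReal.toReal_ofNat, ENNReal.rpow_ofNat, one_div]
    congr 1
    rw [show (fun x => ‖(galerkinVelocity (freqBall (N n)) (α n) t - u t) x‖ₑ ^ 2) =
        fun x => ‖(galerkinVelocity (freqBall (N n)) (α n) t - u t) x‖ₑ ^ 2 from rfl,
      lintegral_enorm_sq_eq_ofReal hmem]
    congr 1
    exact integral_congr_ae (ae_of_all _ fun x => by simp only [Pi.sub_apply]; rw [norm_sub_rev])
  simp_rw [heq]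
  have h1 : Tendsto (fun n => ENNReal.ofReal (∫ x, ‖u t x - galerkinVelocity (freqBall (N n)) (α n) t x‖ ^ 2))
      atTop (𝓝 0) := by
    have h := ENNReal.tendsto_ofReal hWt
    rwa [ENNReal.ofReal_zero] at h
  have hc : ContinuousAt (fun a : ℝ≥0∞ => a ^ (1 / 2 : ℝ)) 0 := ENNReal.continuous_rpow_const.continuousAt
  have h2 := hc.tendsto.comp h1
  rw [ENNReal.zero_rpow_of_pos (by norm_num : (0 : ℝ) < 1 / 2)] at h2
  exact h2

end Discharge

end Literature.Analysis.FluidPDE
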